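import Summits.ResolutionOfSingularities.ResolutionOfSingularities.Theses.RisoStrata
import Summits.ResolutionOfSingularities.ResolutionOfSingularities.Theses.Descent
import Summits.ResolutionOfSingularities.ResolutionOfSingularities.Theses.UniformComplexity
import Summits.ResolutionOfSingularities.ResolutionOfSingularities.Theses.EquisingularLift
import Summits.ResolutionOfSingularities.ResolutionOfSingularities.Theses.TropicalLinks
import Summits.ResolutionOfSingularities.ResolutionOfSingularities.Theses.AbhyankarShadows
import Summits.ResolutionOfSingularities.ResolutionOfSingularities.Theses.TeissierJung
import Literature.Barriers.ResolutionOfSingularities.InseparableBaseChangeResolution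
import Summits.ResolutionOfSingularities.ResolutionOfSingularities.Theses.WeightedInvariant
import Summits.ResolutionOfSingularities.ResolutionOfSingularities.Theorems.WeightedThesis.Negative.LoadBearing

/-!
# Crux attack — `RisoStrata.DescentAlgclosedToPerfect` (stmt-ResolutionOfSingularities-0550)

refuter-rattack-stmt-ResolutionOfSingularities-0550-0, 2026-08-17 (one cycle, route
`route-ResolutionOfSingularities-RisoStrata`, rank 4; the item is SHARED verbatim with routes
Descent r3 / UniformComplexity r4 / EquisingularLift r5 / TropicalLinks r4 / AbhyankarShadows r5 /
TeissierJung r5).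

The crux: `∀ p prime, AlgClosedRes p → PerfectRes p` — resolution of every reduced separated
finite-type scheme over every ALGEBRAICALLY CLOSED field of characteristic `p` implies the same over
every PERFECT field of characteristic `p` (existence-only Galois descent of resolutions).

Everything below is sorry-free and kernel-checked (`lean check` rc 0). Findings:

* A. ELABORATION / SHARING: rc 0; the body restated standalone is `Iff.rfl` (`crux_iff`); the
  RisoStrata copy is `rfl`-equal to the six other routes' copies (`crux_eq_*`). Both sides live in
  universe 0 (`k : Type`, `Scheme.{0}`), as the summit; `AlgebraicClosure k : Type` for `k : Type`,
  so the Galois-descent instance the crux needs is inside the quantified range (no universe escape).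
* B. RESTATES-THE-SUMMIT PROBES: `S → C` (`crux_of_summit`), hence `¬ C → ¬ S`
  (`not_summit_of_not_crux`): the crux is irrefutable unless the summit is false.
  `C → S` is NOT available by logic: `S ↔ (∀ p prime, AlgClosedRes p) ∧ C ∧ DescentPerfectToAll`
  (`summit_iff`), and the pair of descent cruxes is EXACTLY the factorisation of
  "algebraically closed ⇒ all fields" through perfect fields (`algClosedToAll_iff_crux_and_perfectToAll`).
  Route-relative: the three riso cruxes yield the antecedent (`algClosedRes_of_riso`, the inner term
  of `closes`), so given the other four hypotheses of `closes`, `C ↔ S` (`crux_iff_summit_of_others`).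
  `¬ C ↔ ∃ p prime, AlgClosedRes p ∧ ¬ PerfectRes p` (`not_crux_iff`): a refutation must PROVE
  resolution over all algebraically closed fields of some characteristic (open from dimension 4) AND
  exhibit a non-resolvable variety over a perfect field — unfalsifiable by instances, no finite or
  computable falsifier exists.
* C. VACUITY / TRIVIALITY / DEGENERATE / MUTATION: `simp`/`aesop`/`exact?` fail on `C`, cannot derive
  `False` from the antecedent and cannot prove the consequent (Scratch.lean probes, rc 1 ×6).
  The consequent implies the antecedent (`algClosedRes_of_perfectRes`: algebraically closed fields
  are perfect), so `C ↔ ∀ p prime, (AlgClosedRes p ↔ PerfectRes p)` (`crux_iff_iff`).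
  The field classes are genuinely different (`zmod_perfect_not_algClosed`: `𝔽_p` is perfect, not
  algebraically closed) — the first instance with content is descent from `𝔽̄_p` to `𝔽_p`.
  `p.Prime` is near-decoration (`cruxWithoutPrime_iff`: only `p = 0` is added, where the statement is
  Hironaka in weak form, `cruxAtZero_of_hironaka`; no field has another non-prime characteristic).
  Replacing `[IsAlgClosed k]` by `[PerfectField k]` in the antecedent gives the identity
  (`cruxWithPerfectAntecedent`) — `IsAlgClosed` is the load-bearing restriction.
  Dropping `[PerfectField k]` from the consequent gives `C ∧ DescentPerfectToAll` (above).
  Dropping `IsReduced X` from the consequent makes it FALSE (`Spec 𝔽_p[ε]`,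
  `not_perfectResNonreduced`), so that mutation is equivalent to `∀ p prime, ¬ AlgClosedRes p`
  (`cruxWithoutReducedConsequent_iff`) — false as soon as resolution holds over one `𝔽̄_p`-world;
  dropping it from the antecedent makes the crux vacuously true (`cruxWithNonreducedAntecedent`).
  Integral suffices on both sides (`algClosedRes_iff_integral`, `perfectRes_iff_integral`; the
  antecedent is route Descent's `DescentThesis`, `descentThesis_iff`). Degenerate instances of the
  consequent: `X` regular / empty (`consequent_of_regular`), `dim X ≤ 3` under `CossartPiltant2019`
  (`consequent_of_dim_le_three`) — any counterexample to the consequent is a ≥ 4-dimensional variety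
  over a perfect, non-algebraically-closed field; over an algebraically closed ground field the
  consequent IS the antecedent (`crux_at_algClosed`).
* D. POSITION: `WeightedThesis ↔ DescentThesis ∧ C` (`weightedThesis_iff_descentThesis_and_crux`):
  the crux is exactly the distance from route Descent's thesis (k̄, stmt-0547) to route
  WeightedInvariant's thesis (perfect k, stmt-0569); the landed negative lemmas on `WeightedThesis`
  transfer (`cruxWithoutLFTConsequent_iff`: `LocallyOfFiniteType` load-bearing on the right, witness
  `Spec 𝔽_p[X]⁺`; `consequentDomain_has_singular_member`: the cusp; `crux_iff_minimalCase_of_algClosedRes`: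
  modulo `CossartPiltant2019` and the antecedent, the crux is the projective integral `dim > 3` case
  over perfect fields). No landed theorem mentions the decl itself except
  `Theorems.PAlterationPicoverCruxMap` (route hypotheses ⇒ Picover). Printed descent k̄ ⇒ perfect k exists only for Galois-EQUIVARIANT
  (functorial) resolutions (Kollár 2007 3.34.2 / Thm 3.36; BGMW 2011 Remark p. 23); from bare
  existence one gets `Y_L → X_L → X`, an alteration of degree `[L:k]`, and Galois-symmetrised fibre
  products / norm ideals are singular (route Descent's recorded stall). Open lemma, not a misstatement.

Verdict: SURVIVES (correctly typed; irrefutable relative to the summit; not closable by logic —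
needs an equivariant-resolution / canonicity input; `[difficulty: L]` is optimistic).
-/

noncomputable section

set_option linter.dupNamespace false

open CategoryTheory CategoryTheory.Limits AlgebraicGeometry
open Literature.AlgebraicGeometry.Resolution
open Summit.ResolutionOfSingularities.ResolutionOfSingularities

namespace Summit.ResolutionOfSingularities.ResolutionOfSingularities.Cruxes.DescentAlgclosedToPerfect.CruxAttackRisoStrata

/-- The antecedent of the crux at `p`: resolution over ALGEBRAICALLY CLOSED fields of char `p`. -/
def AlgClosedRes (p : ℕ) : Prop :=
  ∀ (k : Type) [Field k] [CharP k p] [IsAlgClosed k] (X : Scheme.{0}) (f : X ⟶ Spec (.of k)),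
    IsSeparated f → LocallyOfFiniteType f → QuasiCompact f → IsReduced X → Scheme.HasResolution X

/-- The consequent of the crux at `p`: resolution over PERFECT fields of characteristic `p`. -/
def PerfectRes (p : ℕ) : Prop :=
  ∀ (k : Type) [Field k] [CharP k p] [PerfectField k] (X : Scheme.{0}) (f : X ⟶ Spec (.of k)),
    IsSeparated f → LocallyOfFiniteType f → QuasiCompact f → IsReduced X → Scheme.HasResolution X

/-! ## A. Elaboration and sharing -/

theorem crux_iff :
    Theses.RisoStrata.DescentAlgclosedToPerfect ↔
      ∀ p : ℕ, p.Prime → AlgClosedRes p → PerfectRes p := Iff.rfl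

theorem crux_eq_descent :
    Theses.RisoStrata.DescentAlgclosedToPerfect = Theses.Descent.DescentAlgclosedToPerfect := rfl

theorem crux_eq_uniformComplexity :
    Theses.RisoStrata.DescentAlgclosedToPerfect = Theses.UniformComplexity.DescentAlgclosedToPerfect := rfl

theorem crux_eq_equisingularLift :
    Theses.RisoStrata.DescentAlgclosedToPerfect = Theses.EquisingularLift.DescentAlgclosedToPerfect := rfl

theorem crux_eq_tropicalLinks :
    Theses.RisoStrata.DescentAlgclosedToPerfect = Theses.TropicalLinks.DescentAlgclosedToPerfect := rfl

theorem crux_eq_abhyankarShadows :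
    Theses.RisoStrata.DescentAlgclosedToPerfect = Theses.AbhyankarShadows.DescentAlgclosedToPerfect := rfl

theorem crux_eq_teissierJung :
    Theses.RisoStrata.DescentAlgclosedToPerfect = Theses.TeissierJung.DescentAlgclosedToPerfect := rfl

/-! ## B. Restates-the-summit probes -/

theorem perfectRes_of_resolutionInChar {p : ℕ} (h : ResolutionInChar.{0} p) : PerfectRes p :=
  fun k _ _ _ X f hs hl hq hr => h k X f hs hl hq hr

/-- The consequent implies the antecedent: an algebraically closed field is perfect. -/
theorem algClosedRes_of_perfectRes {p : ℕ} (h : PerfectRes p) : AlgClosedRes p :=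
  fun k _ _ _ X f hs hl hq hr => h k X f hs hl hq hr

theorem algClosedRes_of_resolutionInChar {p : ℕ} (h : ResolutionInChar.{0} p) : AlgClosedRes p :=
  algClosedRes_of_perfectRes (perfectRes_of_resolutionInChar h)

/-- Hence the crux says the two resolution statements are EQUIVALENT prime by prime. -/
theorem crux_iff_iff :
    Theses.RisoStrata.DescentAlgclosedToPerfect ↔
      ∀ p : ℕ, p.Prime → (AlgClosedRes p ↔ PerfectRes p) :=
  ⟨fun h p hp => ⟨h p hp, algClosedRes_of_perfectRes⟩, fun h p hp => (h p hp).mp⟩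

/-- `S → C`: the crux is a consequence of the summit (hence irrefutable unless the summit fails). -/
theorem crux_of_summit (h : _root_.ResolutionOfSingularities) :
    Theses.RisoStrata.DescentAlgclosedToPerfect :=
  fun p hp _ => perfectRes_of_resolutionInChar ((_root_.ResolutionOfSingularities_iff.mp h) p hp)

/-- Certificate for the harness: refuting the crux refutes the summit. -/
theorem not_summit_of_not_crux (h : ¬ Theses.RisoStrata.DescentAlgclosedToPerfect) :
    ¬ _root_.ResolutionOfSingularities :=
  fun hs => h (crux_of_summit hs)

/-- `¬ C` unfolds to: some prime `p` with resolution over ALL algebraically closed fields of char `p`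
AND a failure of resolution over some perfect field of char `p` — unfalsifiable by instances. -/
theorem not_crux_iff :
    ¬ Theses.RisoStrata.DescentAlgclosedToPerfect ↔
      ∃ p : ℕ, p.Prime ∧ AlgClosedRes p ∧ ¬ PerfectRes p := by
  rw [crux_iff]; push Not; rfl

/-- `S ↔ antecedent ∧ C ∧ DescentPerfectToAll`: the summit splits along the two descent cruxes. -/
theorem summit_iff :
    _root_.ResolutionOfSingularities ↔
      (∀ p : ℕ, p.Prime → AlgClosedRes p) ∧ Theses.RisoStrata.DescentAlgclosedToPerfect ∧
        Theses.RisoStrata.DescentPerfectToAll :=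
  ⟨fun h => ⟨fun p hp => algClosedRes_of_resolutionInChar ((_root_.ResolutionOfSingularities_iff.mp h) p hp),
      crux_of_summit h, fun p hp _ => (_root_.ResolutionOfSingularities_iff.mp h) p hp⟩,
    fun ⟨hA, hC, hD⟩ => _root_.ResolutionOfSingularities_iff.mpr fun p hp => hD p hp (hC p hp (hA p hp))⟩

/-- The two shared descent cruxes are EXACTLY the factorisation of "algebraically closed ⇒ all
fields of char `p`" through perfect fields (because perfect-field resolution gives back the
algebraically closed case for free). -/
theorem algClosedToAll_iff_crux_and_perfectToAll :
    (∀ p : ℕ, p.Prime → AlgClosedRes p → ResolutionInChar.{0} p) ↔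
      Theses.RisoStrata.DescentAlgclosedToPerfect ∧ Theses.RisoStrata.DescentPerfectToAll :=
  ⟨fun h => ⟨fun p hp hA => perfectRes_of_resolutionInChar (h p hp hA),
      fun p hp hP => h p hp (algClosedRes_of_perfectRes hP)⟩,
    fun ⟨hC, hD⟩ p hp hA => hD p hp (hC p hp hA)⟩

/-- Route-relative probe: the three riso cruxes of the route give exactly the antecedent (this is the
inner term of `Theses.RisoStrata.closes`). -/
theorem algClosedRes_of_riso (hLoc : Theses.RisoStrata.RtdLocal) (hRes : Theses.RisoStrata.RisoCentresResolve)
    (hGlob : Theses.RisoStrata.RisoGlobalisation) (p : ℕ) (hp : p.Prime) : AlgClosedRes p :=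
  fun k _ _ _ X f _ _ _ _ =>
    Literature.AlgebraicGeometry.Resolution.ComponentGluing.hasResolution_of_forall_closeds X f
      fun Z hZ => hGlob p hp (hLoc p hp) (hRes p hp) k _
        (CategoryTheory.CategoryStruct.comp
          (AlgebraicGeometry.Scheme.IdealSheafData.vanishingIdeal Z).subschemeι f)
        inferInstance inferInstance inferInstance hZ

/-- Hence, inside route RisoStrata, the crux is equivalent to the summit given the other four
hypotheses of `closes`. -/
theorem crux_iff_summit_of_others (hLoc : Theses.RisoStrata.RtdLocal)
    (hRes : Theses.RisoStrata.RisoCentresResolve) (hGlob : Theses.RisoStrata.RisoGlobalisation)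
    (hPerf : Theses.RisoStrata.DescentPerfectToAll) :
    Theses.RisoStrata.DescentAlgclosedToPerfect ↔ _root_.ResolutionOfSingularities :=
  ⟨fun hC => Theses.RisoStrata.closes hLoc hRes hGlob hC hPerf, crux_of_summit⟩

/-- Inside route Descent: the antecedent of the crux is that route's thesis (integral ⇔ reduced by
the landed component gluing). -/
theorem descentThesis_iff :
    Theses.Descent.DescentThesis ↔ ∀ p : ℕ, p.Prime → AlgClosedRes p :=
  ⟨fun hT p hp k _ _ _ => Theses.Descent.DescentReducedToIntegral_holds k
      fun X f h1 h2 h3 h4 => hT p hp k X f h1 h2 h3 h4,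
    fun hA p hp k _ _ _ X f hs hl hq _ => hA p hp k X f hs hl hq inferInstance⟩

/-! ## C. Degenerate instances / hypothesis mutation -/

/-- The two field classes differ: `𝔽_p` is perfect and not algebraically closed, so the consequent
quantifies over strictly more ground fields than the antecedent (first instance with content:
descent from `𝔽̄_p` to `𝔽_p`). -/
theorem zmod_perfect_not_algClosed (p : ℕ) [Fact p.Prime] :
    PerfectField (ZMod p) ∧ ¬ IsAlgClosed (ZMod p) :=
  ⟨inferInstance, fun h => by
    haveI := h
    haveI : Infinite (ZMod p) := IsAlgClosed.instInfinite
    exact not_finite (ZMod p)⟩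

/-- `p.Prime` is near-decoration: without it only `p = 0` is added (no field has a composite or unit
characteristic), where the statement is resolution in characteristic zero in weak form. -/
theorem cruxWithoutPrime_iff :
    (∀ p : ℕ, AlgClosedRes p → PerfectRes p) ↔
      Theses.RisoStrata.DescentAlgclosedToPerfect ∧ (AlgClosedRes 0 → PerfectRes 0) := by
  refine ⟨fun h => ⟨fun p _ => h p, h 0⟩, fun ⟨h, h0⟩ p hA k _ _ _ X f hs hl hq hr => ?_⟩
  rcases CharP.char_is_prime_or_zero k p with hp | rfl
  · exact h p hp hA k X f hs hl hq hr
  · exact h0 hA k X f hs hl hq hr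

/-- The `p = 0` clause is Hironaka's theorem (named fact, weak form). -/
theorem cruxAtZero_of_hironaka (h : Hironaka1964.{0}) : AlgClosedRes 0 → PerfectRes 0 :=
  fun _ => perfectRes_of_resolutionInChar h

/-- Replacing `[IsAlgClosed k]` by `[PerfectField k]` in the antecedent makes the crux the identity:
`IsAlgClosed` is the load-bearing restriction. -/
theorem cruxWithPerfectAntecedent : ∀ p : ℕ, p.Prime → PerfectRes p → PerfectRes p := fun _ _ h => h

/-- The consequent with `IsReduced X` dropped. -/
def PerfectResNonreduced (p : ℕ) : Prop :=
  ∀ (k : Type) [Field k] [CharP k p] [PerfectField k] (X : Scheme.{0}) (f : X ⟶ Spec (.of k)),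
    IsSeparated f → LocallyOfFiniteType f → QuasiCompact f → Scheme.HasResolution X

/-- The antecedent with `IsReduced X` dropped. -/
def AlgClosedResNonreduced (p : ℕ) : Prop :=
  ∀ (k : Type) [Field k] [CharP k p] [IsAlgClosed k] (X : Scheme.{0}) (f : X ⟶ Spec (.of k)),
    IsSeparated f → LocallyOfFiniteType f → QuasiCompact f → Scheme.HasResolution X

/-- `Spec k[ε] → Spec k` (separated, finite type, one non-reduced point) has no resolution. -/
theorem not_hasResolution_dualNumber (k : Type) [Field k] :
    ¬ Scheme.HasResolution (Spec (.of (DualNumber k))) :=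
  Literature.Barriers.ResolutionOfSingularities.not_hasResolution_Spec_dualNumber k

/-- Dropping `IsReduced` from the consequent makes it false over every field (witness `Spec 𝔽_p[ε]`). -/
theorem not_perfectResNonreduced (p : ℕ) [Fact p.Prime] : ¬ PerfectResNonreduced p := fun h =>
  not_hasResolution_dualNumber (ZMod p)
    (h (ZMod p) (Spec (.of (DualNumber (ZMod p))))
      (Spec.map (CommRingCat.ofHom (algebraMap (ZMod p) (DualNumber (ZMod p))))) inferInstance
      (Literature.Barriers.ResolutionOfSingularities.locallyOfFiniteType_Spec_dualNumber (ZMod p))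
      inferInstance)

/-- … and over algebraically closed fields too (witness `Spec 𝔽̄_p[ε]`). -/
theorem not_algClosedResNonreduced (p : ℕ) [Fact p.Prime] : ¬ AlgClosedResNonreduced p := fun h =>
  not_hasResolution_dualNumber (AlgebraicClosure (ZMod p))
    (h (AlgebraicClosure (ZMod p)) (Spec (.of (DualNumber (AlgebraicClosure (ZMod p)))))
      (Spec.map (CommRingCat.ofHom
        (algebraMap (AlgebraicClosure (ZMod p)) (DualNumber (AlgebraicClosure (ZMod p))))))
      inferInstance
      (Literature.Barriers.ResolutionOfSingularities.locallyOfFiniteType_Spec_dualNumber _)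
      inferInstance)

/-- MUTATION (consequent without `IsReduced`): equivalent to the failure of resolution over
algebraically closed fields in EVERY prime characteristic — false as soon as the antecedent holds
for one prime; `IsReduced` on the right is load-bearing. -/
theorem cruxWithoutReducedConsequent_iff :
    (∀ p : ℕ, p.Prime → AlgClosedRes p → PerfectResNonreduced p) ↔ ∀ p : ℕ, p.Prime → ¬ AlgClosedRes p :=
  ⟨fun h p hp hA => by haveI : Fact p.Prime := ⟨hp⟩; exact not_perfectResNonreduced p (h p hp hA),
    fun h p hp hA => absurd hA (h p hp)⟩

/-- MUTATION (antecedent without `IsReduced`): the antecedent becomes false, the crux vacuous. -/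
theorem cruxWithNonreducedAntecedent : ∀ p : ℕ, p.Prime → AlgClosedResNonreduced p → PerfectRes p :=
  fun p hp hA => by haveI : Fact p.Prime := ⟨hp⟩; exact absurd hA (not_algClosedResNonreduced p)

/-- Integral suffices in the antecedent (resolve the components and glue — landed). -/
theorem algClosedRes_iff_integral (p : ℕ) :
    AlgClosedRes p ↔ ∀ (k : Type) [Field k] [CharP k p] [IsAlgClosed k] (X : Scheme.{0})
      (f : X ⟶ Spec (.of k)), IsSeparated f → LocallyOfFiniteType f → QuasiCompact f → IsIntegral X →
        Scheme.HasResolution X :=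
  ⟨fun h k _ _ _ X f hs hl hq _ => h k X f hs hl hq inferInstance,
    fun h k _ _ _ X f _ _ _ _ =>
      Literature.AlgebraicGeometry.Resolution.ComponentGluing.hasResolution_of_forall_closeds X f
        fun Z hZ => h k _ (CategoryTheory.CategoryStruct.comp
          (AlgebraicGeometry.Scheme.IdealSheafData.vanishingIdeal Z).subschemeι f)
          inferInstance inferInstance inferInstance hZ⟩

/-- Integral suffices in the consequent. -/
theorem perfectRes_iff_integral (p : ℕ) :
    PerfectRes p ↔ ∀ (k : Type) [Field k] [CharP k p] [PerfectField k] (X : Scheme.{0})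
      (f : X ⟶ Spec (.of k)), IsSeparated f → LocallyOfFiniteType f → QuasiCompact f → IsIntegral X →
        Scheme.HasResolution X :=
  ⟨fun h k _ _ _ X f hs hl hq _ => h k X f hs hl hq inferInstance,
    fun h k _ _ _ X f _ _ _ _ =>
      Literature.AlgebraicGeometry.Resolution.ComponentGluing.hasResolution_of_forall_closeds X f
        fun Z hZ => h k _ (CategoryTheory.CategoryStruct.comp
          (AlgebraicGeometry.Scheme.IdealSheafData.vanishingIdeal Z).subschemeι f)
          inferInstance inferInstance inferInstance hZ⟩

/-- Degenerate instance: over an ALGEBRAICALLY CLOSED ground field the consequent is the antecedent. -/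
theorem crux_at_algClosed (p : ℕ) (hA : AlgClosedRes p) (k : Type) [Field k] [CharP k p]
    [IsAlgClosed k] (X : Scheme.{0}) (f : X ⟶ Spec (.of k)) [IsSeparated f] [LocallyOfFiniteType f]
    [QuasiCompact f] [IsReduced X] : Scheme.HasResolution X :=
  hA k X f ‹_› ‹_› ‹_› ‹_›

/-- Degenerate instance of the consequent: a regular `X` (e.g. `∅`, `Spec k`, `𝔸ⁿ`) is its own
resolution. -/
theorem consequent_of_regular (X : Scheme.{0}) (h : Scheme.IsRegular X) : Scheme.HasResolution X :=
  h.hasResolution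

/-- Degenerate instance of the consequent: dimension `≤ 3` is Cossart–Piltant (named fact), over any
field — a counterexample to the consequent is a variety of dimension `≥ 4` over a perfect field. -/
theorem consequent_of_dim_le_three (hCP : CossartPiltant2019.{0}) {p : ℕ} (k : Type) [Field k]
    [CharP k p] [PerfectField k] (X : Scheme.{0}) (f : X ⟶ Spec (.of k)) [IsSeparated f]
    [LocallyOfFiniteType f] [QuasiCompact f] [IsReduced X] (hdim : topologicalKrullDim X ≤ 3) :
    Scheme.HasResolution X :=
  hasResolution_of_dim_le_three hCP k X f hdim

/-! ## D. Position: the crux is exactly the gap between two route theses -/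

/-- Route WeightedInvariant's thesis (stmt-0569) is resolution over PERFECT fields, i.e. the
consequent of this crux at every prime. -/
theorem weightedThesis_iff : Theses.WeightedInvariant.WeightedThesis ↔ ∀ p : ℕ, p.Prime → PerfectRes p :=
  Iff.rfl

/-- `WeightedThesis → C` (the crux is weaker than resolution over perfect fields). -/
theorem crux_of_weightedThesis (h : Theses.WeightedInvariant.WeightedThesis) :
    Theses.RisoStrata.DescentAlgclosedToPerfect := fun p hp _ => h p hp

/-- **`WeightedThesis ↔ DescentThesis ∧ C`**: the crux is EXACTLY the distance from route Descent's
thesis (integral, algebraically closed ground field; stmt-0547) to route WeightedInvariant's thesis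
(reduced, perfect ground field; stmt-0569). -/
theorem weightedThesis_iff_descentThesis_and_crux :
    Theses.WeightedInvariant.WeightedThesis ↔
      Theses.Descent.DescentThesis ∧ Theses.RisoStrata.DescentAlgclosedToPerfect :=
  ⟨fun h => ⟨descentThesis_iff.mpr fun p hp => algClosedRes_of_perfectRes (h p hp), crux_of_weightedThesis h⟩,
    fun ⟨hT, hC⟩ p hp => hC p hp (descentThesis_iff.mp hT p hp)⟩

/-- MUTATION (consequent without `LocallyOfFiniteType f`), transferred from the landed negative lemma
`Theorems.WeightedThesis.Negative.weightedThesis_false_without_locallyOfFiniteType_at` (witness: the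
absolute integral closure `Spec 𝔽_p[X]⁺ → Spec 𝔽_p`, reduced, affine, no resolution): the mutated
crux is again equivalent to the failure of the antecedent at every prime. -/
theorem cruxWithoutLFTConsequent_iff :
    (∀ p : ℕ, p.Prime → AlgClosedRes p → ∀ (k : Type) [Field k] [CharP k p] [PerfectField k]
        (X : Scheme.{0}) (f : X ⟶ Spec (.of k)), IsSeparated f → QuasiCompact f → IsReduced X →
          Scheme.HasResolution X) ↔ ∀ p : ℕ, p.Prime → ¬ AlgClosedRes p :=
  ⟨fun h p hp hA => by
      haveI : Fact p.Prime := ⟨hp⟩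
      exact Theorems.WeightedThesis.Negative.weightedThesis_false_without_locallyOfFiniteType_at p
        (h p hp hA),
    fun h p hp hA => absurd hA (h p hp)⟩

/-- STRENGTHENING refuted (transferred): "every reduced separated finite-type scheme over a perfect
field is already regular" is false at every prime (cusp `Spec 𝔽_p[T²,T³]`), so the consequent has
content — `HasResolution X` is not witnessed by `𝟙 X` — and the domain of the consequent has a
non-junk, singular inhabitant. -/
theorem consequentDomain_has_singular_member (p : ℕ) [Fact p.Prime] :
    ¬ ∀ (k : Type) [Field k] [CharP k p] [PerfectField k] (Y : Scheme.{0})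
        (f : Y ⟶ Spec (.of k)), IsSeparated f → LocallyOfFiniteType f → QuasiCompact f →
          IsReduced Y → Scheme.IsRegular Y :=
  Theorems.WeightedThesis.Negative.weightedThesis_strengthening_isRegular_false p

/-- SHAPE OF A MINIMAL COUNTEREXAMPLE (transferred, modulo `CossartPiltant2019`): if the antecedent
holds at every prime, the crux is equivalent to resolving INTEGRAL closed subschemes of `ℙⁿ_k` of
dimension `> 3` over PERFECT fields `k` — a refutation is a ≥ 4-dimensional projective variety over
a perfect, non-algebraically-closed field with no resolution, TOGETHER WITH resolution over all
algebraically closed fields of that characteristic. -/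
theorem crux_iff_minimalCase_of_algClosedRes (hCP : CossartPiltant2019.{0})
    (hA : ∀ p : ℕ, p.Prime → AlgClosedRes p) :
    Theses.RisoStrata.DescentAlgclosedToPerfect ↔
      ∀ p : ℕ, p.Prime → ∀ (k : Type) [Field k] [CharP k p] [PerfectField k] (n : ℕ) (X : Scheme.{0})
        (ι : X ⟶ (Literature.AlgebraicGeometry.Motives.projectiveSpace n k).left),
        IsClosedImmersion ι → IsIntegral X → ¬ topologicalKrullDim X ≤ 3 → Scheme.HasResolution X := by
  rw [← Theorems.WeightedThesis.Negative.weightedThesis_iff_minimalCase hCP,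
    weightedThesis_iff_descentThesis_and_crux]
  exact ⟨fun hC => ⟨descentThesis_iff.mpr hA, hC⟩, fun h => h.2⟩

end Summit.ResolutionOfSingularities.ResolutionOfSingularities.Cruxes.DescentAlgclosedToPerfect.CruxAttackRisoStrata
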